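/-
Copyright: statement-level skeleton of a published paper (lit-balaban cell, Phase-2 proof seat p13, gen 6). No proof
claims beyond what the kernel checks below.
-/
import Literature.MathematicalPhysics.QuantumFieldTheory.BalabanImbrieJaffe1984to88.BIJ88Eq248Lattice

/-!
# `BalabanImbrieJaffe1984to88.BIJ88WalkGaugeCovariance` — T. Bałaban, J. Imbrie, A. Jaffe, *Effective action and
cluster properties of the abelian Higgs model*, Commun. Math. Phys. **114** (1988) 257–315 [BalabanImbrieJaffe1988],
§2 p. 265 [PDF 9]: **the GAUGE COVARIANCE of every operator introduced through the random walk expansion** — *"all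
operators introduced through random walk expansions of C^{(k)}_Λ(u) or G_k(Ω, u) transform properly under gauge
transformations, that is, by the difference of the gauge transformation between the points of evaluation of the
kernel"* — PROVED FOR THE `ℤ^d` OPERATORS OF [6] = [Balaban1983RegularityDecay] Sect. 5 (the walk terms
`BIJ88Eq242Lattice.latticeCw`, the local part `C_{Λ,loc}` (2.43) and the parts `C_{Λ,X}` (2.44)).

statement-level skeleton of published theorems with citation tags; proofs where landed; nothing here is a claim
about the Yang–Mills mass gap

PDF held: `paper:balaban1988-cmp114-bij-abelian-higgs-effective-action` (journal page = PDF page + 256; p. 265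
read with `lit read … --pages 9`).

CITATION HEADER (lean-in-tree rule).  lit-balaban cell (HOME `run/shared/lean/pub/lit-balaban/`), Phase 2, seat p13
gen 6 (unit `lit-balaban-p13-g6`); the p. 265 sentence belongs to rows **C2.Eq2.42–2.45** of
`HOME/lit-balaban-r18/ROWS-C2.md` (owner r18, referee ref-5).  Files USED BY NAME, nothing restated:
`…B4GaugeCovariance` (`blockOp`, `blockDiag`, `IsGauge`, `blockOp_gaugeKer`, `blockDiag_mul_blockOp`,
`blockOp_mul_blockDiag`, `blockDiag_transpose`, `blockDiag_mul_blockDiag`, `blockDiag_transpose_mul_self`,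
`blockDiag_mul_transpose_self`, `conj_inv`), `…B4Commutators25to211` (`mulH`), `…B6GOmega` (`inclMatrix`,
`inclMatrix_apply`, `inclMatrix_conj`), `…B4` (`B4.Idx`, `B4.inclIdx`, `B4.compress`, `B4.Hyp56`),
`…B4Sect5CubeBounds` (the cube system on `ℤ^d`: `labels`, `hFam`, `pFam`, `cOp`/`cFam`, `kR`, `thetaConst`),
`…B4Sect5RandomWalk` (`walkTerm517`, `aFac`, `bFac`, `rPair`), `…B4RandomWalk213` (`bprod`),
`…BIJ88RandomWalk242` (`Walk`, `Near`, `cLoc`, `region`, `cX`), `…BIJ88Eq242Lattice` (`flatten`, `latticeCw`),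
`…BIJ88Ineq246Lattice` (p251520: `LTup`, `term`, `latticeCw_flatten'`, `ldist`, `Cubes`, `cubeOf`, `touch`,
`summable_abs_indicator_term`, `tsum_indicator_latticeCw_eq`), `…BIJ88Eq248Lattice` (`compress_apply`).

## The print (verbatim, p. 265)

*"Note that all operators introduced through random walk expansions of C^{(k)}_Λ(u) or G_Λ(Ω, u) transform
properly under gauge transformations, that is, by the difference of the gauge transformation between the points of
evaluation of the kernel."*

## What is proved

A (lattice) gauge transformation on `L²(Λ; ℝ^N)` is a sitewise orthogonal `N × N` block `g(x)`
(`B4GaugeCovariance.IsGauge`; for the abelian Higgs model: the rotation of `ℂ ≅ ℝ²` by the angle `e_kλ(x)`), acting on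
operators by conjugation `X ↦ 𝒢X𝒢ᵀ`, `𝒢 = blockDiag g` (`gconj`); on a kernel this is `K(x₁,x₂) ↦
g(x₁)K(x₁,x₂)g(x₂)ᵀ` = *"the difference of the gauge transformation between the points of evaluation"* (`sandwich`,
`gconj_apply`).  THEN, for the operators of [6] Sect. 5 built from `A` and from `𝒢A𝒢ᵀ`:
* §1–§2 conjugation is a ring map fixing the cube system: `gconj` respects `*, +, −, Σ, ⁻¹, 1`, fixes every
  multiplication operator (`gconj_mulH`: `h_j`, `□_j`), passes to Dirichlet compressions (`compress_gconj`:
  `(𝒢A𝒢ᵀ)|_{Λ′} = 𝒢′A|_{Λ′}𝒢′ᵀ`) and to the local inverses `C_j` (`gconj_cOp`), to `R_{j,j′}` (`gconj_rPair`) and to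
  EVERY WALK TERM of (5.17)/(2.42): `C_ω[𝒢A𝒢ᵀ] = 𝒢C_ω[A]𝒢ᵀ` (`gconj_term`, `gconj_latticeCw`) — termwise, for ANY
  `A`, no (5.6).  Also `[𝒢A𝒢ᵀ]^{−1} = 𝒢A^{−1}𝒢ᵀ` and the same for every `[·|_{Λ′}]^{−1}` of (2.39) (`inv_gconj`,
  `compress_inv_gconj`).
* §3 the resummed parts: under [6] (5.6) for `A` and cubes `M ≥ 5`, `M > K_R`, `M > Θ₁` (absolute convergence of the
  expansion, `summable_abs_indicator_term`), the local part (2.43) and every `X`-part (2.44) of `𝒢A𝒢ᵀ` are the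
  sandwiched ones of `A`: `C_{Λ,loc}[𝒢A𝒢ᵀ](x₁,x₂) = g(x₁)C_{Λ,loc}[A](x₁,x₂)g(x₂)ᵀ` (`cLoc_gauge`),
  `C_{Λ,X}[𝒢A𝒢ᵀ](x₁,x₂) = g(x₁)C_{Λ,X}[A](x₁,x₂)g(x₂)ᵀ` (`cX_gauge`) — the primed/class restrictions see only the walk
  and the SITES of `x₁, x₂`, not their components.
* §4 (v1.1, append-only) [6]'s (5.6) is gauge invariant up to `c₀ ↦ N²c₀` (`hyp56_gconj`: symmetry `isSymm_gconj`,
  form bound via `form_gconj`/`sum_sq_transpose_mulVec`, entry decay via `abs_entry_le_one`), so the expansion and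
  every row proved for [6]'s operators apply to `𝒢A𝒢ᵀ` (`eq242_lattice_gconj`).
HONEST SCOPE.  Operators of [6] Sect. 5 only (as in `BIJ88Eq242Lattice`); that the print's operator
`Δ_{k,loc}(u) + aL^{−2}Q(u)*Q(u)` of (2.40) at the transformed background `u^λ` IS the conjugate `𝒢_λ(·)𝒢_λᵀ` of the
one at `u` is the model's input (gauge covariance of the averaging operators and of `G_{k,loc}(u)`, cf. rows
C2.Eq2.10/2.11), displayed here as the hypothesis "`A′ = 𝒢A𝒢ᵀ`", not proved.  No `sorry`; no new `Prop` fact.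
-/

namespace Literature.MathematicalPhysics.QuantumFieldTheory.BalabanImbrieJaffe1984to88.BIJ88WalkGaugeCovariance

open scoped BigOperators
open Finset
open Literature.MathematicalPhysics.QuantumFieldTheory.Balaban1983to89
open Literature.MathematicalPhysics.QuantumFieldTheory.BalabanImbrieJaffe1984to88
open B4GaugeCovariance B4Commutators25to211 B4RandomWalk213 B4Sect5RandomWalk B4Sect5CubeBounds B6GOmega
  BIJ88RandomWalk242 BIJ88Eq242Lattice BIJ88Ineq246Lattice BIJ88Eq248Lattice

open scoped Matrix

variable {d N : ℕ} {Λ : Finset (Fin d → ℤ)}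

/-! ## §1 Gauge conjugation `X ↦ 𝒢X𝒢ᵀ` on `L²(Λ; ℝ^N)` and its kernel form -/

/-- *"the difference of the gauge transformation between the points of evaluation of the kernel"*: the kernel
`K(x₁, x₂) ↦ g(x₁)K(x₁, x₂)g(x₂)ᵀ` (as `N × N` blocks), written on entry-kernels `K ((x₁,i),(x₂,j))`.
[cite: BalabanImbrieJaffe1988, p.265 (gauge covariance of the random walk operators)] -/
def sandwich (g : ↥Λ → Matrix (Fin N) (Fin N) ℝ) (K : B4.Idx Λ N → B4.Idx Λ N → ℝ) (p q : B4.Idx Λ N) : ℝ :=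
  ∑ j, (∑ i, g p.1 p.2 i * K (p.1, i) (q.1, j)) * g q.1 q.2 j

/-- the sandwich at `(x₁, x₂)` sees the kernel only at the sites of `x₁, x₂` (all components). [cite:
BalabanImbrieJaffe1988, p.265 (gauge covariance of the random walk operators)] -/
theorem sandwich_congr {g : ↥Λ → Matrix (Fin N) (Fin N) ℝ} {K K' : B4.Idx Λ N → B4.Idx Λ N → ℝ}
    {p q : B4.Idx Λ N} (h : ∀ i j, K (p.1, i) (q.1, j) = K' (p.1, i) (q.1, j)) :
    sandwich g K p q = sandwich g K' p q := by
  unfold sandwich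
  refine Finset.sum_congr rfl fun j _ => ?_
  rw [Finset.sum_congr rfl fun i _ => by rw [h i j]]

/-- GAUGE CONJUGATION of an operator on `L²(Λ; ℝ^N)` by the sitewise transformation `g`: `X ↦ 𝒢X𝒢ᵀ`,
`𝒢 = blockDiag g`. [cite: BalabanImbrieJaffe1988, p.265 (gauge covariance of the random walk operators)] -/
def gconj (g : ↥Λ → Matrix (Fin N) (Fin N) ℝ) (X : Matrix (B4.Idx Λ N) (B4.Idx Λ N) ℝ) :
    Matrix (B4.Idx Λ N) (B4.Idx Λ N) ℝ :=
  blockDiag g * X * (blockDiag g)ᵀ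

variable {g : ↥Λ → Matrix (Fin N) (Fin N) ℝ}

/-- every operator on `L²(Λ; ℝ^N)` is the block operator of its `N × N` block kernel. [folklore] (bookkeeping for
Bałaban–Imbrie–Jaffe, CMP **114**, p. 265) -/
private theorem eq_blockOp (X : Matrix (B4.Idx Λ N) (B4.Idx Λ N) ℝ) :
    X = blockOp fun x y => (fun i j => X (x, i) (y, j) : Matrix (Fin N) (Fin N) ℝ) := by
  ext p q
  rfl

/-- **the kernel of the conjugate is the sandwiched kernel**: `(𝒢X𝒢ᵀ)((x₁,i),(x₂,j)) =
Σ_{i′,j′} g(x₁)_{ii′} X((x₁,i′),(x₂,j′)) g(x₂)_{jj′}`, i.e. `g(x₁)X(x₁,x₂)g(x₂)ᵀ` blockwise.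
[cite: BalabanImbrieJaffe1988, p.265 (gauge covariance of the random walk operators)] -/
theorem gconj_apply (g : ↥Λ → Matrix (Fin N) (Fin N) ℝ) (X : Matrix (B4.Idx Λ N) (B4.Idx Λ N) ℝ)
    (p q : B4.Idx Λ N) : gconj g X p q = sandwich g X p q := by
  obtain ⟨K, rfl⟩ : ∃ K : ↥Λ → ↥Λ → Matrix (Fin N) (Fin N) ℝ, X = blockOp K := ⟨_, eq_blockOp X⟩
  unfold gconj sandwich
  rw [← blockOp_gaugeKer, blockOp_apply, gaugeKer_apply]
  simp only [Matrix.mul_apply, Matrix.transpose_apply, blockOp_apply]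

/-- conjugation is additive. [cite: BalabanImbrieJaffe1988, p.265 (gauge covariance of the random walk operators)] -/
theorem gconj_add (X Y : Matrix (B4.Idx Λ N) (B4.Idx Λ N) ℝ) : gconj g (X + Y) = gconj g X + gconj g Y := by
  unfold gconj
  rw [Matrix.mul_add, Matrix.add_mul]

/-- conjugation respects subtraction. [cite: BalabanImbrieJaffe1988, p.265 (gauge covariance of the random walk operators)] -/
theorem gconj_sub (X Y : Matrix (B4.Idx Λ N) (B4.Idx Λ N) ℝ) : gconj g (X - Y) = gconj g X - gconj g Y := by
  unfold gconj
  rw [Matrix.mul_sub, Matrix.sub_mul]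

/-- conjugation respects negation. [cite: BalabanImbrieJaffe1988, p.265 (gauge covariance of the random walk operators)] -/
theorem gconj_neg (X : Matrix (B4.Idx Λ N) (B4.Idx Λ N) ℝ) : gconj g (-X) = -gconj g X := by
  unfold gconj
  rw [Matrix.mul_neg, Matrix.neg_mul]

/-- conjugation of zero. [cite: BalabanImbrieJaffe1988, p.265 (gauge covariance of the random walk operators)] -/
theorem gconj_zero : gconj g (0 : Matrix (B4.Idx Λ N) (B4.Idx Λ N) ℝ) = 0 := by
  unfold gconj
  rw [Matrix.mul_zero, Matrix.zero_mul]

/-- conjugation commutes with finite sums. [cite: BalabanImbrieJaffe1988, p.265 (gauge covariance of the random walk operators)] -/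
theorem gconj_sum {J : Type*} (s : Finset J) (f : J → Matrix (B4.Idx Λ N) (B4.Idx Λ N) ℝ) :
    gconj g (∑ j ∈ s, f j) = ∑ j ∈ s, gconj g (f j) := by
  unfold gconj
  rw [Finset.mul_sum, Finset.sum_mul]

/-- for a gauge transformation (`g(x)ᵀg(x) = 1`) conjugation is multiplicative: `𝒢XY𝒢ᵀ = 𝒢X𝒢ᵀ·𝒢Y𝒢ᵀ`.
[cite: BalabanImbrieJaffe1988, p.265 (gauge covariance of the random walk operators)] -/
theorem gconj_mul (hg : IsGauge g) (X Y : Matrix (B4.Idx Λ N) (B4.Idx Λ N) ℝ) :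
    gconj g (X * Y) = gconj g X * gconj g Y := by
  unfold gconj
  simp only [Matrix.mul_assoc]
  rw [← Matrix.mul_assoc (blockDiag g)ᵀ (blockDiag g) (Y * (blockDiag g)ᵀ), blockDiag_transpose_mul_self hg,
    Matrix.one_mul]

/-- … and unital. [cite: BalabanImbrieJaffe1988, p.265 (gauge covariance of the random walk operators)] -/
theorem gconj_one (hg : IsGauge g) : gconj g (1 : Matrix (B4.Idx Λ N) (B4.Idx Λ N) ℝ) = 1 := by
  unfold gconj
  rw [Matrix.mul_one, blockDiag_mul_transpose_self hg]

/-- conjugation commutes with inversion (Mathlib's nonsingular inverse, no invertibility hypothesis): the covariance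
`C_Λ = A_Λ^{−1}` transforms like `A`. [cite: BalabanImbrieJaffe1988, p.265 (gauge covariance of the random walk operators)] -/
theorem inv_gconj (hg : IsGauge g) (X : Matrix (B4.Idx Λ N) (B4.Idx Λ N) ℝ) : (gconj g X)⁻¹ = gconj g X⁻¹ :=
  B4GaugeCovariance.conj_inv hg X

/-- conjugation FIXES every multiplication operator (`h_j`, `□_j`, indicators): `𝒢·h·𝒢ᵀ = h`.
[cite: BalabanImbrieJaffe1988, p.265 (gauge covariance of the random walk operators)] -/
theorem gconj_mulH (hg : IsGauge g) (f : ↥Λ → ℝ) : gconj g (mulH (ι := Fin N) f) = mulH (ι := Fin N) f := by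
  unfold gconj mulH
  rw [blockDiag_mul_blockDiag, blockDiag_transpose, blockDiag_mul_blockDiag]
  congr 1
  funext x
  rw [Matrix.mul_smul, Matrix.mul_one, Matrix.smul_mul, hg.mul_transpose x]

/-- ordered products: `𝒢(b₁⋯b_n)𝒢ᵀ = (𝒢b₁𝒢ᵀ)⋯(𝒢b_n𝒢ᵀ)`. [cite: BalabanImbrieJaffe1988, p.265 (gauge covariance of the random walk operators)] -/
theorem gconj_bprod (hg : IsGauge g) {ι : Type*} (b : ι → Matrix (B4.Idx Λ N) (B4.Idx Λ N) ℝ) :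
    ∀ (n : ℕ) (ys : Fin n → ι), gconj g (bprod b n ys) = bprod (fun i => gconj g (b i)) n ys := by
  intro n
  induction n with
  | zero => intro ys; rw [bprod_zero, bprod_zero, gconj_one hg]
  | succ n ih => intro ys; rw [bprod_succ, bprod_succ, gconj_mul hg, ih (Fin.tail ys)]

/-! ## §2 Conjugation passes through the cube system of [6] Sect. 5 and through every walk term -/

section CubeSystem

/-- the restriction of the sitewise transformation to `Λ′ ⊆ Λ`. [cite: BalabanImbrieJaffe1988, p.265 (gauge
covariance of the random walk operators)] -/
def gRes {Λ' : Finset (Fin d → ℤ)} (h : Λ' ⊆ Λ) (g : ↥Λ → Matrix (Fin N) (Fin N) ℝ) :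
    ↥Λ' → Matrix (Fin N) (Fin N) ℝ :=
  fun y => g ⟨y.1, h y.2⟩

/-- the restriction of a gauge transformation is one. [cite: BalabanImbrieJaffe1988, p.265 (gauge covariance of the random walk operators)] -/
theorem isGauge_gRes {Λ' : Finset (Fin d → ℤ)} (h : Λ' ⊆ Λ) (hg : IsGauge g) : IsGauge (gRes h g) :=
  fun y => hg ⟨y.1, h y.2⟩

/-- **Dirichlet compressions are covariant**: `(𝒢X𝒢ᵀ)|_{Λ′} = 𝒢′X|_{Λ′}𝒢′ᵀ` with `𝒢′` the restricted transformation
(the conjugation is sitewise, the compression `A_Λ = ΛAΛ` of (2.39) is by sites). [cite: BalabanImbrieJaffe1988, p.265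
(gauge covariance of the random walk operators), (2.39) p.264] -/
theorem compress_gconj {Λ' : Finset (Fin d → ℤ)} (h : Λ' ⊆ Λ) (g : ↥Λ → Matrix (Fin N) (Fin N) ℝ)
    (X : Matrix (B4.Idx Λ N) (B4.Idx Λ N) ℝ) :
    B4.compress h (gconj g X) = gconj (gRes h g) (B4.compress h X) := by
  ext p q
  rw [compress_apply, gconj_apply, gconj_apply]
  rfl

/-- **the Dirichlet covariances `[·|_{Λ′}]^{−1}` of (2.39) are covariant**: `[(𝒢X𝒢ᵀ)|_{Λ′}]^{−1} = 𝒢′[X|_{Λ′}]^{−1}𝒢′ᵀ`.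
[cite: BalabanImbrieJaffe1988, p.265 (gauge covariance of the random walk operators), (2.39) p.264] -/
theorem compress_inv_gconj {Λ' : Finset (Fin d → ℤ)} (h : Λ' ⊆ Λ) (hg : IsGauge g)
    (X : Matrix (B4.Idx Λ N) (B4.Idx Λ N) ℝ) :
    (B4.compress h (gconj g X))⁻¹ = gconj (gRes h g) (B4.compress h X)⁻¹ := by
  rw [compress_gconj, inv_gconj (isGauge_gRes h hg)]

/-- the zero-extension `ι : L²(Λ′) → L²(Λ)` as a block operator with blocks `1` / `0`. [folklore] (bookkeeping for
Bałaban–Imbrie–Jaffe, CMP **114**, p. 265) -/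
private theorem inclMatrix_eq_blockOp {Λ' : Finset (Fin d → ℤ)} (h : Λ' ⊆ Λ) :
    inclMatrix (N := N) h =
      blockOp fun (x : ↥Λ) (y : ↥Λ') => if x = ⟨y.1, h y.2⟩ then (1 : Matrix (Fin N) (Fin N) ℝ) else 0 := by
  ext p k
  rw [inclMatrix_apply, blockOp_apply]
  by_cases h1 : p.1 = ⟨k.1.1, h k.1.2⟩
  · by_cases h2 : p.2 = k.2
    · have he : p = B4.inclIdx h k := Prod.ext h1 h2
      simp only [if_pos he, if_pos h1, Matrix.one_apply, if_pos h2]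
    · have hne : p ≠ B4.inclIdx h k := fun e => h2 (congrArg Prod.snd e)
      simp only [if_neg hne, if_pos h1, Matrix.one_apply, if_neg h2]
  · have hne : p ≠ B4.inclIdx h k := fun e => h1 (congrArg Prod.fst e)
    simp only [if_neg hne, if_neg h1, Matrix.zero_apply]

/-- the block-diagonal transformation intertwines the zero-extension: `𝒢ι = ι𝒢′`. [cite: BalabanImbrieJaffe1988, p.265
(gauge covariance of the random walk operators)] -/
theorem blockDiag_mul_inclMatrix {Λ' : Finset (Fin d → ℤ)} (h : Λ' ⊆ Λ) (g : ↥Λ → Matrix (Fin N) (Fin N) ℝ) :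
    blockDiag g * inclMatrix (N := N) h = inclMatrix (N := N) h * blockDiag (gRes h g) := by
  rw [inclMatrix_eq_blockOp, blockDiag_mul_blockOp, blockOp_mul_blockDiag]
  congr 1
  funext x y
  by_cases hxy : x = ⟨y.1, h y.2⟩
  · rw [if_pos hxy, Matrix.mul_one, Matrix.one_mul, hxy]
    rfl
  · rw [if_neg hxy, Matrix.mul_zero, Matrix.zero_mul]

/-- … and its transpose: `ιᵀ𝒢ᵀ = 𝒢′ᵀιᵀ`. [cite: BalabanImbrieJaffe1988, p.265 (gauge covariance of the random walk operators)] -/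
theorem inclMatrix_transpose_mul_blockDiag_transpose {Λ' : Finset (Fin d → ℤ)} (h : Λ' ⊆ Λ)
    (g : ↥Λ → Matrix (Fin N) (Fin N) ℝ) :
    (inclMatrix (N := N) h)ᵀ * (blockDiag g)ᵀ = (blockDiag (gRes h g))ᵀ * (inclMatrix (N := N) h)ᵀ := by
  rw [← Matrix.transpose_mul, ← Matrix.transpose_mul, blockDiag_mul_inclMatrix]

variable {M : ℕ} {A : Matrix (B4.Idx Λ N) (B4.Idx Λ N) ℝ}

/-- **the local inverses `C_j = (A|_{□_j})^{−1}` (5.12) are covariant**: `C_j[𝒢A𝒢ᵀ] = 𝒢C_j[A]𝒢ᵀ`.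
[cite: BalabanImbrieJaffe1988, p.265 (gauge covariance of the random walk operators); Balaban1983RegularityDecay, (5.12) p.594] -/
theorem gconj_cOp (hg : IsGauge g) (M : ℕ) (A : Matrix (B4.Idx Λ N) (B4.Idx Λ N) ℝ) (j : Fin d → ℤ) :
    gconj g (cOp M A j) = cOp M (gconj g A) j := by
  unfold cOp
  rw [compress_inv_gconj _ hg]
  unfold gconj
  have h1 := blockDiag_mul_inclMatrix (N := N) (boxSet_subset M Λ j) g
  have h2 := inclMatrix_transpose_mul_blockDiag_transpose (N := N) (boxSet_subset M Λ j) g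
  calc blockDiag g * (inclMatrix (N := N) (boxSet_subset M Λ j) * (B4.compress (boxSet_subset M Λ j) A)⁻¹ *
          (inclMatrix (N := N) (boxSet_subset M Λ j))ᵀ) * (blockDiag g)ᵀ
        = (blockDiag g * inclMatrix (N := N) (boxSet_subset M Λ j)) * (B4.compress (boxSet_subset M Λ j) A)⁻¹ *
          ((inclMatrix (N := N) (boxSet_subset M Λ j))ᵀ * (blockDiag g)ᵀ) := by
        simp only [Matrix.mul_assoc]
    _ = (inclMatrix (N := N) (boxSet_subset M Λ j) * blockDiag (gRes (boxSet_subset M Λ j) g)) *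
          (B4.compress (boxSet_subset M Λ j) A)⁻¹ *
          ((blockDiag (gRes (boxSet_subset M Λ j) g))ᵀ * (inclMatrix (N := N) (boxSet_subset M Λ j))ᵀ) := by
        rw [h1, h2]
    _ = inclMatrix (N := N) (boxSet_subset M Λ j) * (blockDiag (gRes (boxSet_subset M Λ j) g) *
          (B4.compress (boxSet_subset M Λ j) A)⁻¹ * (blockDiag (gRes (boxSet_subset M Λ j) g))ᵀ) *
          (inclMatrix (N := N) (boxSet_subset M Λ j))ᵀ := by
        simp only [Matrix.mul_assoc]

/-- the family `C_j`, `j ∈ labels`, is covariant. [cite: BalabanImbrieJaffe1988, p.265 (gauge covariance of the random walk operators)] -/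
theorem gconj_cFam (hg : IsGauge g) (j : ↥(labels M Λ)) : gconj g (cFam M A j) = cFam M (gconj g A) j :=
  gconj_cOp hg M A j.1

/-- `𝒢h_j𝒢ᵀ = h_j`. [cite: BalabanImbrieJaffe1988, p.265 (gauge covariance of the random walk operators)] -/
theorem gconj_hFam (hg : IsGauge g) (j : ↥(labels M Λ)) : gconj g (hFam N M Λ j) = hFam N M Λ j :=
  gconj_mulH hg _

/-- `𝒢□_j𝒢ᵀ = □_j`. [cite: BalabanImbrieJaffe1988, p.265 (gauge covariance of the random walk operators)] -/
theorem gconj_pFam (hg : IsGauge g) (j : ↥(labels M Λ)) : gconj g (pFam N M Λ j) = pFam N M Λ j :=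
  gconj_mulH hg _

/-- **`R_{j,j′}` of (5.14) is covariant**: `R_{j,j′}[𝒢A𝒢ᵀ] = 𝒢R_{j,j′}[A]𝒢ᵀ` (both printed cases).
[cite: BalabanImbrieJaffe1988, p.265 (gauge covariance of the random walk operators); Balaban1983RegularityDecay, (5.14) p.595] -/
theorem gconj_rPair (hg : IsGauge g) (j j' : ↥(labels M Λ)) :
    gconj g (rPair A (pFam N M Λ) (hFam N M Λ) j j') = rPair (gconj g A) (pFam N M Λ) (hFam N M Λ) j j' := by
  unfold rPair
  split_ifs with hjj
  · rw [gconj_neg, gconj_mul hg, gconj_mul hg, gconj_sub, gconj_mul hg, gconj_mul hg, gconj_pFam hg,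
      gconj_hFam hg]
  · rw [gconj_neg, gconj_mul hg, gconj_mul hg, gconj_mul hg, gconj_sub, gconj_mul hg, gconj_one hg,
      gconj_pFam hg, gconj_hFam hg, gconj_hFam hg]

/-- the vertex factor `h_jC_jh_j` is covariant. [cite: BalabanImbrieJaffe1988, p.265 (gauge covariance of the random walk operators)] -/
theorem gconj_aFac (hg : IsGauge g) (j : ↥(labels M Λ)) :
    gconj g (aFac (hFam N M Λ) (cFam M A) j) = aFac (hFam N M Λ) (cFam M (gconj g A)) j := by
  unfold aFac
  rw [gconj_mul hg, gconj_mul hg, gconj_hFam hg, gconj_cFam hg]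

/-- the pair factor `R_{l,l′}C_{l′}h_{l′}` is covariant. [cite: BalabanImbrieJaffe1988, p.265 (gauge covariance of the random walk operators)] -/
theorem gconj_bFac (hg : IsGauge g) (q : ↥(labels M Λ) × ↥(labels M Λ)) :
    gconj g (bFac A (pFam N M Λ) (hFam N M Λ) (cFam M A) q)
      = bFac (gconj g A) (pFam N M Λ) (hFam N M Λ) (cFam M (gconj g A)) q := by
  unfold bFac
  rw [gconj_mul hg, gconj_mul hg, gconj_rPair hg, gconj_cFam hg, gconj_hFam hg]

/-- **EVERY WALK TERM OF (5.17)/(2.42) IS COVARIANT**: `C_ω[𝒢A𝒢ᵀ] = 𝒢C_ω[A]𝒢ᵀ` for every tuple `ω` — termwise, for ANY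
operator `A` (no (5.6), no convergence). [cite: BalabanImbrieJaffe1988, p.265 (gauge covariance of the random walk
operators), (2.42) p.264] -/
theorem gconj_term (hg : IsGauge g) (cc : LTup M Λ) : gconj g (term M A cc) = term M (gconj g A) cc := by
  have hb : (fun q => gconj g (bFac A (pFam N M Λ) (hFam N M Λ) (cFam M A) q))
      = bFac (gconj g A) (pFam N M Λ) (hFam N M Λ) (cFam M (gconj g A)) := funext fun q => gconj_bFac hg q
  unfold term walkTerm517
  rw [gconj_mul hg, gconj_aFac hg, gconj_bprod hg, hb]

/-- the same on the label sequences `Walk` of (2.42) (`latticeCw`; zero off the flattened tuples).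
[cite: BalabanImbrieJaffe1988, p.265 (gauge covariance of the random walk operators), (2.42) p.264] -/
theorem gconj_latticeCw (hg : IsGauge g) (ω : Walk ↥(labels M Λ)) :
    gconj g (latticeCw M Λ N A ω) = latticeCw M Λ N (gconj g A) ω := by
  by_cases hr : ∃ cc : LTup M Λ, flatten cc = ω
  · obtain ⟨cc, rfl⟩ := hr
    rw [latticeCw_flatten', latticeCw_flatten', gconj_term hg]
  · have hz : ∀ B : Matrix (B4.Idx Λ N) (B4.Idx Λ N) ℝ, latticeCw M Λ N B ω = 0 := fun B => by
      unfold latticeCw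
      exact Function.extend_apply' _ _ _ hr
    rw [hz, hz, gconj_zero]

/-- **kernel form**: `C_ω[𝒢A𝒢ᵀ](x₁, x₂) = g(x₁)C_ω[A](x₁, x₂)g(x₂)ᵀ` — *"by the difference of the gauge transformation
between the points of evaluation of the kernel"*. [cite: BalabanImbrieJaffe1988, p.265 (gauge covariance of the random walk operators)] -/
theorem latticeCw_gauge_apply (hg : IsGauge g) (ω : Walk ↥(labels M Λ)) (p q : B4.Idx Λ N) :
    latticeCw M Λ N (gconj g A) ω p q = sandwich g (latticeCw M Λ N A ω) p q := by
  rw [← gconj_latticeCw hg, gconj_apply]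

end CubeSystem

/-! ## §3 The resummed parts (2.43)/(2.44) of `𝒢A𝒢ᵀ` are the sandwiched parts of `A` -/

section Resummed

variable {M : ℕ} {A : Matrix (B4.Idx Λ N) (B4.Idx Λ N) ℝ} {γ₀ c₀ δ₀ : ℝ}

/-- exchanging an absolutely convergent walk sum with the finite sandwich sums (bookkeeping). [cite:
BalabanImbrieJaffe1988, p.265 (gauge covariance of the random walk operators)] -/
theorem tsum_sandwich {ι : Type*} (F : ι → Fin N → Fin N → ℝ) (hF : ∀ i j, Summable fun cc => F cc i j)
    (a b : Fin N → ℝ) :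
    ∑' cc, ∑ j, (∑ i, a i * F cc i j) * b j = ∑ j, (∑ i, a i * ∑' cc, F cc i j) * b j := by
  have h1 : ∀ i j, Summable fun cc => a i * F cc i j := fun i j => (hF i j).mul_left (a i)
  have h2 : ∀ j, Summable fun cc => ∑ i, a i * F cc i j := fun j => summable_sum fun i _ => h1 i j
  have h3 : ∀ j, Summable fun cc => (∑ i, a i * F cc i j) * b j := fun j => (h2 j).mul_right (b j)
  rw [Summable.tsum_finsetSum fun j _ => h3 j]
  refine Finset.sum_congr rfl fun j _ => ?_
  rw [tsum_mul_right, Summable.tsum_finsetSum fun i _ => h1 i j]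
  refine congrArg (· * b j) (Finset.sum_congr rfl fun i _ => ?_)
  rw [tsum_mul_left]

/-- a class sum of the walk terms of `𝒢A𝒢ᵀ` is the sandwich of the class sums of `A`, for every class `S` of walks
(under (5.6) for `A`: absolute convergence). [cite: BalabanImbrieJaffe1988, p.265 (gauge covariance of the random walk operators)] -/
theorem tsum_indicator_gauge (hγ : 0 < γ₀) (hc : 0 ≤ c₀) (hδ : 0 < δ₀) (hA : B4.Hyp56 Λ A γ₀ c₀ δ₀) (hM : 5 ≤ M)
    (hMR : kR d N γ₀ c₀ δ₀ < M) (hMθ : thetaConst d N γ₀ c₀ δ₀ < M) (hg : IsGauge g)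
    (S : Set (Walk ↥(labels M Λ))) (p q : B4.Idx Λ N) :
    ∑' ω, S.indicator (fun ω => latticeCw M Λ N (gconj g A) ω p q) ω
      = sandwich g (fun y₁ y₂ => ∑' ω, S.indicator (fun ω => latticeCw M Λ N A ω y₁ y₂) ω) p q := by
  classical
  unfold sandwich
  simp_rw [tsum_indicator_latticeCw_eq]
  have hterm : ∀ cc : LTup M Λ, (flatten ⁻¹' S).indicator (fun cc => term M (gconj g A) cc p q) cc
      = ∑ j, (∑ i, g p.1 p.2 i * (flatten ⁻¹' S).indicator (fun cc => term M A cc (p.1, i) (q.1, j)) cc) *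
          g q.1 q.2 j := by
    intro cc
    by_cases hcc : cc ∈ flatten ⁻¹' S
    · simp only [Set.indicator_of_mem hcc]
      rw [← gconj_term hg, gconj_apply]
      rfl
    · simp only [Set.indicator_of_notMem hcc, mul_zero, Finset.sum_const_zero, zero_mul]
  rw [tsum_congr hterm]
  exact tsum_sandwich
    (fun (cc : LTup M Λ) (i j : Fin N) => (flatten ⁻¹' S).indicator (fun cc => term M A cc (p.1, i) (q.1, j)) cc)
    (fun i j => (summable_abs_indicator_term hγ hc hδ hA hM hMR hMθ _ _ _).of_abs) _ _

/-- **THE LOCAL PART (2.43) IS COVARIANT**: under [6] (5.6) for `A` (cubes `M ≥ 5`, `M > K_R`, `M > Θ₁`) and a gauge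
transformation `g`, `C_{Λ,loc}[𝒢A𝒢ᵀ](x₁, x₂) = g(x₁)C_{Λ,loc}[A](x₁, x₂)g(x₂)ᵀ` for every radius `ρ` and all
`x₁, x₂` — the primed restriction *"ω remaining within ¼r(e_k) of x₁, x₂"* sees only the walk and the sites.
[cite: BalabanImbrieJaffe1988, p.265 (gauge covariance of the random walk operators), (2.43) p.264] -/
theorem cLoc_gauge (hγ : 0 < γ₀) (hc : 0 ≤ c₀) (hδ : 0 < δ₀) (hA : B4.Hyp56 Λ A γ₀ c₀ δ₀) (hM : 5 ≤ M)
    (hMR : kR d N γ₀ c₀ δ₀ < M) (hMθ : thetaConst d N γ₀ c₀ δ₀ < M) (hg : IsGauge g) (ρ : ℝ)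
    (p q : B4.Idx Λ N) :
    cLoc (ldist (N := N) M) ρ (fun ω y₁ y₂ => latticeCw M Λ N (gconj g A) ω y₁ y₂) p q
      = sandwich g (cLoc (ldist (N := N) M) ρ (fun ω y₁ y₂ => latticeCw M Λ N A ω y₁ y₂)) p q := by
  have key := tsum_indicator_gauge hγ hc hδ hA hM hMR hMθ hg
    {ω : Walk ↥(labels M Λ) | Near (ldist (N := N) M) ρ ω p q} p q
  unfold cLoc
  rw [key]
  exact sandwich_congr fun _ _ => rfl

/-- **EVERY `X`-PART (2.44) IS COVARIANT**: under the same hypotheses, `C_{Λ,X}[𝒢A𝒢ᵀ](x₁, x₂) =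
g(x₁)C_{Λ,X}[A](x₁, x₂)g(x₂)ᵀ` for every cube set `X` (any `r(e_k)`-cube size `s`, radius `ρ`) and all `x₁, x₂`.
[cite: BalabanImbrieJaffe1988, p.265 (gauge covariance of the random walk operators), (2.44) p.264] -/
theorem cX_gauge {s : ℕ} (hγ : 0 < γ₀) (hc : 0 ≤ c₀) (hδ : 0 < δ₀) (hA : B4.Hyp56 Λ A γ₀ c₀ δ₀) (hM : 5 ≤ M)
    (hMR : kR d N γ₀ c₀ δ₀ < M) (hMθ : thetaConst d N γ₀ c₀ δ₀ < M) (hg : IsGauge g) (ρ : ℝ)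
    (X : Finset (Cubes (d := d) M s Λ)) (p q : B4.Idx Λ N) :
    cX (ldist (N := N) M) ρ (cubeOf M s) touch (fun ω y₁ y₂ => latticeCw M Λ N (gconj g A) ω y₁ y₂) X p q
      = sandwich g (cX (ldist (N := N) M) ρ (cubeOf M s) touch
          (fun ω y₁ y₂ => latticeCw M Λ N A ω y₁ y₂) X) p q := by
  have key := tsum_indicator_gauge hγ hc hδ hA hM hMR hMθ hg
    {ω : Walk ↥(labels M Λ) | ¬ Near (ldist (N := N) M) ρ ω p q ∧ region (cubeOf M s) touch ω = X} p q
  unfold cX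
  rw [key]
  exact sandwich_congr fun _ _ => rfl

/-- **THE FULL COVARIANCE `A_Λ^{−1}` IS COVARIANT** (no hypothesis): `[𝒢A𝒢ᵀ]^{−1}(x₁, x₂) = g(x₁)A^{−1}(x₁, x₂)g(x₂)ᵀ`.
[cite: BalabanImbrieJaffe1988, p.265 (gauge covariance of the random walk operators)] -/
theorem inv_gauge_apply (hg : IsGauge g) (p q : B4.Idx Λ N) :
    (gconj g A)⁻¹ p q = sandwich g (A⁻¹ : Matrix (B4.Idx Λ N) (B4.Idx Λ N) ℝ) p q := by
  rw [inv_gconj hg, gconj_apply]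

end Resummed

/-! ## §4 (v1.1, append-only) [6]'s hypothesis (5.6) is preserved by gauge conjugation

So the random walk expansion (2.42)/(2.45) of [6] Sect. 5 applies to the transformed operator `𝒢A𝒢ᵀ` with the
constants of `A` up to `c₀ ↦ N²c₀` (entrywise typing of (5.6), `B4.Hyp56`): symmetry and the lower bound `≥ γ₀I` are
invariant under the orthogonal `𝒢`, and the entries of `𝒢A𝒢ᵀ` are `N²`-fold sums of entries of `A` at the same pair
of sites with coefficients `|g_{ii′}| ≤ 1`. -/

section Hyp56

variable {A : Matrix (B4.Idx Λ N) (B4.Idx Λ N) ℝ}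

/-- entries of an orthogonal block are at most `1` in absolute value (`Σ_{i′} g_{ri′}² = 1`). [cite:
BalabanImbrieJaffe1988, p.265 (gauge covariance of the random walk operators)] -/
theorem abs_entry_le_one (hg : IsGauge g) (x : ↥Λ) (r i : Fin N) : |g x r i| ≤ 1 := by
  have h := congrFun (congrFun (hg.mul_transpose x) r) r
  rw [Matrix.mul_apply, Matrix.one_apply_eq] at h
  simp only [Matrix.transpose_apply] at h
  have hle : g x r i * g x r i ≤ ∑ i', g x r i' * g x r i' :=
    Finset.single_le_sum (fun i' _ => mul_self_nonneg (g x r i')) (Finset.mem_univ i)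
  rw [h] at hle
  exact abs_le_one_iff_mul_self_le_one.mpr hle

/-- conjugation preserves symmetry: `(𝒢A𝒢ᵀ)ᵀ = 𝒢A𝒢ᵀ` for symmetric `A`. [cite: BalabanImbrieJaffe1988, p.265 (gauge
covariance of the random walk operators)] -/
theorem isSymm_gconj (hA : A.IsSymm) : (gconj g A).IsSymm := by
  show (blockDiag g * A * (blockDiag g)ᵀ)ᵀ = blockDiag g * A * (blockDiag g)ᵀ
  rw [Matrix.transpose_mul, Matrix.transpose_mul, Matrix.transpose_transpose, hA.eq, Matrix.mul_assoc]

/-- the quadratic form of the conjugate is the form of `A` at the back-transformed vector: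
`⟨v, 𝒢A𝒢ᵀv⟩ = ⟨𝒢ᵀv, A𝒢ᵀv⟩`. [cite: BalabanImbrieJaffe1988, p.265 (gauge covariance of the random walk operators)] -/
theorem form_gconj (v : B4.Idx Λ N → ℝ) :
    ∑ p, v p * (gconj g A).mulVec v p
      = ∑ p, ((blockDiag g)ᵀ *ᵥ v) p * A.mulVec ((blockDiag g)ᵀ *ᵥ v) p := by
  change v ⬝ᵥ ((blockDiag g * A * (blockDiag g)ᵀ) *ᵥ v) = ((blockDiag g)ᵀ *ᵥ v) ⬝ᵥ (A *ᵥ ((blockDiag g)ᵀ *ᵥ v))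
  rw [Matrix.mul_assoc, ← Matrix.mulVec_mulVec, ← Matrix.mulVec_mulVec, Matrix.dotProduct_mulVec,
    ← Matrix.mulVec_transpose]

/-- an orthogonal `𝒢` preserves the `ℓ²` norm: `|𝒢ᵀv|² = |v|²`. [cite: BalabanImbrieJaffe1988, p.265 (gauge covariance of
the random walk operators)] -/
theorem sum_sq_transpose_mulVec (hg : IsGauge g) (v : B4.Idx Λ N → ℝ) :
    ∑ p, ((blockDiag g)ᵀ *ᵥ v) p ^ 2 = ∑ p, v p ^ 2 := by
  have h : ((blockDiag g)ᵀ *ᵥ v) ⬝ᵥ ((blockDiag g)ᵀ *ᵥ v) = v ⬝ᵥ v := by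
    rw [Matrix.dotProduct_mulVec, Matrix.vecMul_transpose, Matrix.mulVec_mulVec, blockDiag_mul_transpose_self hg,
      Matrix.one_mulVec, dotProduct_comm]
  simpa only [dotProduct, sq] using h

/-- **(5.6) IS GAUGE INVARIANT (entrywise typing: `c₀ ↦ N²c₀`)**: if `A` satisfies [6] (5.6) with `(γ₀, c₀, δ₀)` and `g`
is a gauge transformation, then `𝒢A𝒢ᵀ` satisfies (5.6) with `(γ₀, N²c₀, δ₀)` — so [6]'s expansion and all the rows
proved for it (`BIJ88Eq242Lattice`, `BIJ88Ineq246Lattice`, `BIJ88Eq248Lattice`, §3 above) apply to the transformed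
operator as well. [cite: BalabanImbrieJaffe1988, p.265 (gauge covariance of the random walk operators);
Balaban1983RegularityDecay, (5.6) p.594] -/
theorem hyp56_gconj {γ₀ c₀ δ₀ : ℝ} (hg : IsGauge g) (hA : B4.Hyp56 Λ A γ₀ c₀ δ₀) :
    B4.Hyp56 Λ (gconj g A) γ₀ ((N : ℝ) ^ 2 * c₀) δ₀ := by
  obtain ⟨hsymm, hform, hdec⟩ := hA
  refine ⟨isSymm_gconj hsymm, fun v => ?_, fun p q => ?_⟩
  · rw [form_gconj, ← sum_sq_transpose_mulVec hg v]
    exact hform _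
  · rw [gconj_apply]
    unfold sandwich
    have hg1 : ∀ (x : ↥Λ) (r i : Fin N), |g x r i| ≤ 1 := fun x r i => abs_entry_le_one hg x r i
    have hdist : ∀ i j : Fin N,
        |A (p.1, i) (q.1, j)| ≤ c₀ * Real.exp (-(δ₀ * dist (p.1 : Fin d → ℤ) (q.1 : Fin d → ℤ))) :=
      fun i j => hdec (p.1, i) (q.1, j)
    calc |∑ j, (∑ i, g p.1 p.2 i * A (p.1, i) (q.1, j)) * g q.1 q.2 j|
        ≤ ∑ j, |(∑ i, g p.1 p.2 i * A (p.1, i) (q.1, j)) * g q.1 q.2 j| := Finset.abs_sum_le_sum_abs _ _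
      _ ≤ ∑ j, ∑ i, |A (p.1, i) (q.1, j)| := by
          refine Finset.sum_le_sum fun j _ => ?_
          rw [abs_mul]
          calc |∑ i, g p.1 p.2 i * A (p.1, i) (q.1, j)| * |g q.1 q.2 j|
              ≤ |∑ i, g p.1 p.2 i * A (p.1, i) (q.1, j)| * 1 :=
                mul_le_mul_of_nonneg_left (hg1 _ _ _) (abs_nonneg _)
            _ ≤ ∑ i, |A (p.1, i) (q.1, j)| := by
                rw [mul_one]
                refine (Finset.abs_sum_le_sum_abs _ _).trans (Finset.sum_le_sum fun i _ => ?_)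
                rw [abs_mul]
                calc |g p.1 p.2 i| * |A (p.1, i) (q.1, j)| ≤ 1 * |A (p.1, i) (q.1, j)| :=
                      mul_le_mul_of_nonneg_right (hg1 _ _ _) (abs_nonneg _)
                  _ = |A (p.1, i) (q.1, j)| := one_mul _
      _ ≤ ∑ _j : Fin N, ∑ _i : Fin N, c₀ * Real.exp (-(δ₀ * dist (p.1 : Fin d → ℤ) (q.1 : Fin d → ℤ))) :=
          Finset.sum_le_sum fun j _ => Finset.sum_le_sum fun i _ => hdist i j
      _ = (N : ℝ) ^ 2 * c₀ * Real.exp (-(δ₀ * dist (p.1 : Fin d → ℤ) (q.1 : Fin d → ℤ))) := by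
          simp only [Finset.sum_const, Finset.card_univ, Fintype.card_fin]
          ring

/-- hence, under (5.6) for `A`, EVERY ROW PROVED FOR [6]'s OPERATORS holds for `𝒢A𝒢ᵀ` with `c₀ ↦ N²c₀`; for instance the
expansion (2.42) itself converges for the transformed operator (here with the cube-size thresholds of `N²c₀`).
[cite: BalabanImbrieJaffe1988, (2.42) p.264, p.265 (gauge covariance of the random walk operators)] -/
theorem eq242_lattice_gconj {γ₀ c₀ δ₀ : ℝ} (hγ : 0 < γ₀) (hc : 0 ≤ c₀) (hδ : 0 < δ₀) (hg : IsGauge g)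
    (hA : B4.Hyp56 Λ A γ₀ c₀ δ₀) {M : ℕ} (hM : 5 ≤ M) (hMR : kR d N γ₀ ((N : ℝ) ^ 2 * c₀) δ₀ < M)
    (hMθ : thetaConst d N γ₀ ((N : ℝ) ^ 2 * c₀) δ₀ < M) :
    Eq242 (fun x₁ x₂ : B4.Idx Λ N => (gconj g A)⁻¹ x₁ x₂) (fun ω x₁ x₂ => latticeCw M Λ N (gconj g A) ω x₁ x₂) :=
  eq242_lattice hγ (by positivity) hδ (hyp56_gconj hg hA) hM hMR hMθ

end Hyp56

end Literature.MathematicalPhysics.QuantumFieldTheory.BalabanImbrieJaffe1984to88.BIJ88WalkGaugeCovariance
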